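import Literature.MathematicalPhysics.QuantumFieldTheory.Balaban1983to89.T4CouplingMatching
import Mathlib.Analysis.Complex.Trigonometric
import Literature.Probability.LatticeModels.TorusFourier

/-!
# Spine/NE4/LatticeArtifactRate — (R58) THE OTHER `L⁻²`: the (AF-0r)-half's mechanism in its simplest kernel form — the free lattice dispersion at
# spacing `η = L^{−k}` converges to the continuum symbol `p²` at the GEOMETRIC rate `(L⁻²)^k` (an `η²` = dimension-6 lattice artifact), i.e. it satisfies the
# β sub-cell's (AF-0r) shape `|β⁰_k − β⁰_∞| ≤ c₀·θ^k` and NE4's `ScaleShiftRate` shape with `θ = L⁻²`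

Cell `pub-balaban-gaps` (YM blitz G2), seat `ne4`, generation 16 (unit `pub-balaban-gaps-ne4-g16`); record `HOME/ne/NE4.md` §5 (R58).

HONEST FRAMING.  NE4 = `T4CouplingMatching.ScaleShiftRate` is NOT IN PRINT ([Balaban1987RG1] = CMP **109** (1987) p. 264) and NOT proved; its β⁰-half (AF-0r) —
`|β⁰_{k+1} − β⁰_∞| ≤ c₀θ^k` for Bałaban's ONE-LOOP coefficient, the field `Beta.Assembly.LimitForm.conv` — is OPEN (rows an1∕an2 of the β sub-cell).  This file proves
NOTHING about Bałaban's propagators.  It isolates, as a kernel statement, the MECHANISM the cell's own data attribute to (AF-0r) — an `O(η²)` lattice artifact decaying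
by `L⁻²` per renormalization step ((R50): «θ = L⁻² EXACT for the linear block covariance, asymptotic for the one-loop coefficient — a pure O(η²) artifact») — on the
simplest carrier of that artifact: the symbol of the free lattice Laplacian.  Elementary real analysis (Mathlib's `Real.cos_bound`); a MODEL statement; no status word
moves (NE4 stays DEPENDENT; spine 0∕9).  One finite T⁴; NOT ℝ⁴, NOT infinite volume, NOT a mass gap, NOT Clay.

THE POINT (companion of (R57)).  (R57) computed the row's rate `θ = L⁻²` for NE4's HISTORY∕remainder half as the leading even irrelevant factor of the Gaussian-linearised
block map (Wick degree 6 ↦ `L^{4−6}`).  NE4's OTHER half is (AF-0r) (`AsymptoticContent.scaleShiftRate_iff_split`: NE4 ⟺ (AF-0r) ∧ `RemainderShiftRate`), whose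
expected rate is ALSO `L⁻²`, for a different-looking reason: the one-loop coefficient at step `k` is computed with lattice propagators of spacing `η = L^{−k}` (in the unit of
the current block lattice), and lattice propagators differ from their continuum limits by `O(η²·p⁴)` — Symanzik's dimension-6 artifact `a²·p⁴∕12` of the nearest-neighbour
Laplacian, the SAME dimension count as (R57)'s degree 6.  Here:
* §1 `latSym N p = 2N²(1 − cos(p∕N))` — the symbol of the one-dimensional nearest-neighbour Laplacian at spacing `1∕N` (`= (2N·sin(p∕2N))²`, `latSym_eq_sin_sq`);
  `0 ≤ latSym N p ≤ p²` (`latSym_nonneg`, `latSym_le_sq`).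
* §2 **`abs_latSym_sub_sq_le`**: `|latSym N p − p²| ≤ (5∕48)·p⁴∕N²` for `|p| ≤ N` (`Real.cos_bound`; the exact leading term is `p⁴∕(12N²)`).
* §3 the η-SEQUENCE at scale factor `L`: `dispersion L k p = latSym (L^k) p` (spacing `η_k = L^{−k}`); **`abs_dispersion_sub_sq_le`**: for `1 ≤ L`, `|p| ≤ 1`:
  `|dispersion L k p − p²| ≤ (5∕48)·p⁴·(L⁻²)^k` — VERBATIM the (AF-0r) shape `∀ k, |β⁰ k − β⁰_∞| ≤ c₀·θ^k` of `Beta.Assembly.LimitForm.conv` with `θ = L⁻²`,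
  `β⁰_∞ = p²`, `c₀ = (5∕48)p⁴` (`conv_shape_dispersion`); the consecutive form `|dispersion L (k+1) p − dispersion L k p| ≤ (5∕24)·p⁴·(L⁻²)^k`
  (`dispersion_step_le`); and NE4's OWN shape for the history-free family `β_{k+1}(…) := dispersion L (k+1) p`:
  **`scaleShiftRate_dispersion`**: `ScaleShiftRate ((5∕24)·p⁴·L⁻²) (L⁻²) γ (ofMarkov (fun k _ ↦ dispersion L k p))`.
* §4 the `d`-dimensional symbol `Σ_μ latSym N p_μ` obeys the same bound with `Σ_μ p_μ⁴` (`abs_latSymSum_sub_le`).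

WHAT THIS SAYS FOR THE ROW (census (R58); classification words UNCHANGED — DEPENDENT; NOT IN PRINT; NOT PROVED; 0∕9): both halves of NE4 now have a kernel MODEL instance
of the rate `L⁻²` by ONE dimension count — (R57): irrelevant Wick degree 6 (history half); (R58): the `η²p⁴` lattice artifact (β⁰ half) —, matching the cell's MODEL data
((R50) `r^B_m = 2^{−3−2m}` at `L = 2`; the one-loop scalar coefficient's ratios → 0.2502).  For Bałaban's (1.22) the carriers of the `η²` artifact are the propagators and
minimisers of [Balaban1985BackgroundPropagators] (rows NE2∕NE3: η-UNIFORM bounds printed, η-DIFFERENCE bounds located, NOT proved); nothing here touches them.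
NOT PRINTED for lattice gauge theory as a rate statement; nothing of Bałaban's asserted; NE4 NOT proved.

v2 (same generation, APPEND): §5 the PROPAGATOR form — for a mass `m > 0` the massive free lattice propagator's symbol `(m² + latSym N p)⁻¹` differs from the continuum
`(m² + p²)⁻¹` by `≤ (5∕48)·p⁴∕(N²m⁴)` (`abs_inv_massive_sub_le`, resolvent identity; at spacing `L^{−k}`: rate `(L⁻²)^k`, `abs_inv_massive_scale_sub_le`) — the scalar prototype of
rows NE2∕NE3's η-DIFFERENCE bounds for Bałaban's propagators (located there, NOT proved; nothing of theirs is touched); §6 the LINK to the tree's lattice dispersion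
`Literature.Probability.LatticeModels.dispersion ε(p) = Σᵢ(1 − cos pᵢ)` (half the symbol of `−Δ` on `ℤ^d`, `latticeLaplacianZd_cos_sum_mul`): `latSymSum N p = 2N²·ε(p∕N)`
(`latSymSum_eq_dispersion`), so §4's bound reads `|2N²·ε(p∕N) − Σ_μ p_μ²| ≤ (5∕48)(Σ_μ p_μ⁴)∕N²` (`abs_dispersionZd_scaled_sub_le`).
-/

noncomputable section

namespace Summit.QuantumFields.BalabanUV.T4Continuum.Spine.NE4

open Literature.MathematicalPhysics.QuantumFieldTheory.Balaban1983to89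
open Literature.MathematicalPhysics.QuantumFieldTheory.Balaban1983to89.FlowStep
open Literature.MathematicalPhysics.QuantumFieldTheory.Balaban1983to89.T4CouplingMatching (ScaleShiftRate scaleShiftRate_ofMarkov_iff)
open Finset

namespace LatticeArtifact

/-! ## §1 The symbol of the nearest-neighbour Laplacian at spacing `1∕N` -/

section Symbol

/-- THE LATTICE DISPERSION at spacing `1∕N`: `latSym N p = 2N²(1 − cos(p∕N))` — the Fourier symbol of the one-dimensional nearest-neighbour Laplacian
`(f(x+1∕N) − 2f(x) + f(x−1∕N))·N²` at momentum `p` (`= (2N sin(p∕2N))²`).  A MODEL object (free field); NOT Bałaban's propagator. [folklore] -/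
def latSym (N p : ℝ) : ℝ := 2 * N ^ 2 * (1 - Real.cos (p / N))

/-- [bookkeeping] `latSym N p = (2N·sin(p∕(2N)))²`. [folklore] -/
theorem latSym_eq_sin_sq (N p : ℝ) : latSym N p = (2 * N * Real.sin (p / (2 * N))) ^ 2 := by
  rw [latSym]
  have h : Real.cos (p / N) = 1 - 2 * Real.sin (p / (2 * N)) ^ 2 := by
    rw [show p / N = 2 * (p / (2 * N)) by ring, Real.cos_two_mul, Real.cos_sq']
    ring
  rw [h]; ring

/-- [bookkeeping] `0 ≤ latSym N p`. [folklore] -/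
theorem latSym_nonneg (N p : ℝ) : 0 ≤ latSym N p := by
  rw [latSym_eq_sin_sq]; positivity

/-- [bookkeeping] THE LATTICE SYMBOL NEVER EXCEEDS THE CONTINUUM ONE: `latSym N p ≤ p²` (`1 − cos x ≤ x²∕2`; `N ≠ 0`). [folklore] -/
theorem latSym_le_sq {N : ℝ} (hN : N ≠ 0) (p : ℝ) : latSym N p ≤ p ^ 2 := by
  have h := Real.one_sub_sq_div_two_le_cos (x := p / N)
  have hN2 : 0 < N ^ 2 := by positivity
  rw [latSym]
  have : 2 * N ^ 2 * (1 - Real.cos (p / N)) ≤ 2 * N ^ 2 * ((p / N) ^ 2 / 2) :=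
    mul_le_mul_of_nonneg_left (by linarith) (by positivity)
  calc 2 * N ^ 2 * (1 - Real.cos (p / N)) ≤ 2 * N ^ 2 * ((p / N) ^ 2 / 2) := this
    _ = p ^ 2 := by field_simp

end Symbol

/-! ## §2 The `η²` artifact: `|latSym N p − p²| ≤ (5∕48)·p⁴∕N²` -/

section Artifact

/-- **THE DIMENSION-6 LATTICE ARTIFACT**: for `|p| ≤ N` (momenta below the cutoff), `|latSym N p − p²| ≤ (5∕48)·p⁴∕N²` — the nearest-neighbour symbol differs from
the continuum one by `O(η²p⁴)` at spacing `η = 1∕N` (exact leading term `p⁴∕(12N²)`; constant `5∕48` from Mathlib's `Real.cos_bound`). [folklore] -/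
theorem abs_latSym_sub_sq_le {N p : ℝ} (hN : 0 < N) (hp : |p| ≤ N) : |latSym N p - p ^ 2| ≤ 5 / 48 * p ^ 4 / N ^ 2 := by
  have hx : |p / N| ≤ 1 := by
    rw [abs_div, abs_of_pos hN, div_le_one hN]; exact hp
  have hcos := Real.cos_bound hx
  have e : latSym N p - p ^ 2 = -(2 * N ^ 2) * (Real.cos (p / N) - (1 - (p / N) ^ 2 / 2)) := by
    rw [latSym]; field_simp; ring
  rw [e, abs_mul, abs_neg, abs_of_pos (by positivity : (0 : ℝ) < 2 * N ^ 2)]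
  calc 2 * N ^ 2 * |Real.cos (p / N) - (1 - (p / N) ^ 2 / 2)| ≤ 2 * N ^ 2 * (|p / N| ^ 4 * (5 / 96)) :=
        mul_le_mul_of_nonneg_left hcos (by positivity)
    _ = 5 / 48 * p ^ 4 / N ^ 2 := by
        rw [abs_div, abs_of_pos hN, div_pow, show |p| ^ 4 = p ^ 4 by rw [pow_abs, abs_of_nonneg (by positivity)]]
        field_simp
        ring

end Artifact

/-! ## §3 The η-sequence at scale factor `L`: the (AF-0r) shape and NE4's shape with `θ = L⁻²` -/

section Sequence

/-- THE DISPERSION AT THE `k`-th SCALE: spacing `η_k = L^{−k}` in the unit of the current block lattice, i.e. `N = L^k`. [folklore] -/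
def dispersion (L : ℝ) (k : ℕ) (p : ℝ) : ℝ := latSym (L ^ k) p

/-- [bookkeeping] `((L^k)²)⁻¹ = (L⁻²)^k`. [folklore] -/
theorem inv_sq_pow (L : ℝ) (k : ℕ) : ((L ^ k) ^ 2)⁻¹ = (L⁻¹ ^ 2) ^ k := by
  rw [← pow_mul, ← pow_mul, mul_comm k 2, inv_pow]

/-- **THE (AF-0r) SHAPE WITH `θ = L⁻²`**: for `1 ≤ L` and a probe momentum `|p| ≤ 1` (below the unit-lattice cutoff, hence below every finer one),
`|dispersion L k p − p²| ≤ (5∕48)·p⁴·(L⁻²)^k` — the free symbol forgets the ultraviolet cutoff GEOMETRICALLY, rate `L⁻²` per step, constant `(5∕48)p⁴`. [folklore] -/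
theorem abs_dispersion_sub_sq_le {L : ℝ} (hL : 1 ≤ L) {p : ℝ} (hp : |p| ≤ 1) (k : ℕ) :
    |dispersion L k p - p ^ 2| ≤ 5 / 48 * p ^ 4 * (L⁻¹ ^ 2) ^ k := by
  have hL0 : 0 < L := lt_of_lt_of_le one_pos hL
  have hN : 0 < L ^ k := pow_pos hL0 k
  have hpN : |p| ≤ L ^ k := hp.trans (one_le_pow₀ hL)
  have h := abs_latSym_sub_sq_le hN hpN
  rw [dispersion]
  calc |latSym (L ^ k) p - p ^ 2| ≤ 5 / 48 * p ^ 4 / (L ^ k) ^ 2 := h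
    _ = 5 / 48 * p ^ 4 * (L⁻¹ ^ 2) ^ k := by rw [div_eq_mul_inv, inv_sq_pow]

/-- **VERBATIM THE β SUB-CELL's (AF-0r) FIELD SHAPE** (`Beta.Assembly.LimitForm.conv : ∀ k, |S.β0 k − binf| ≤ c₀ * θ ^ k`): the sequence `β0 k := dispersion L k p` has
`binf = p²`, `c₀ = (5∕48)p⁴ ≥ 0`, `θ = L⁻² ∈ [0,1[` for `L > 1`.  A MODEL instance of the shape; NOT Bałaban's `β⁰`. [folklore] -/
theorem conv_shape_dispersion {L : ℝ} (hL : 1 < L) {p : ℝ} (hp : |p| ≤ 1) :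
    ∃ binf c₀ θ : ℝ, 0 ≤ c₀ ∧ 0 ≤ θ ∧ θ < 1 ∧ ∀ k, |dispersion L k p - binf| ≤ c₀ * θ ^ k := by
  have hL0 : 0 < L := one_pos.trans hL
  refine ⟨p ^ 2, 5 / 48 * p ^ 4, L⁻¹ ^ 2, by positivity, by positivity, ?_, abs_dispersion_sub_sq_le hL.le hp⟩
  have h1 : L⁻¹ < 1 := inv_lt_one_of_one_lt₀ hL
  have h0 : 0 ≤ L⁻¹ := (inv_pos.2 hL0).le
  nlinarith

/-- **THE CONSECUTIVE (SCALE-SHIFT) FORM**: `|dispersion L (k+1) p − dispersion L k p| ≤ (5∕24)·p⁴·(L⁻²)^k` (triangle inequality through `p²`; `(L⁻²)^{k+1} ≤ (L⁻²)^k`).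
[folklore] -/
theorem dispersion_step_le {L : ℝ} (hL : 1 ≤ L) {p : ℝ} (hp : |p| ≤ 1) (k : ℕ) :
    |dispersion L (k + 1) p - dispersion L k p| ≤ 5 / 24 * p ^ 4 * (L⁻¹ ^ 2) ^ k := by
  have hL0 : 0 < L := lt_of_lt_of_le one_pos hL
  have h1 := abs_dispersion_sub_sq_le hL hp (k + 1)
  have h2 := abs_dispersion_sub_sq_le hL hp k
  have hθ1 : L⁻¹ ^ 2 ≤ 1 := by
    have : L⁻¹ ≤ 1 := inv_le_one_of_one_le₀ hL
    have h0 : 0 ≤ L⁻¹ := (inv_pos.2 hL0).le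
    nlinarith
  have hpow : (L⁻¹ ^ 2) ^ (k + 1) ≤ (L⁻¹ ^ 2) ^ k := pow_le_pow_of_le_one (by positivity) hθ1 (Nat.le_succ k)
  have hp4 : 0 ≤ 5 / 48 * p ^ 4 := by positivity
  calc |dispersion L (k + 1) p - dispersion L k p|
      = |(dispersion L (k + 1) p - p ^ 2) - (dispersion L k p - p ^ 2)| := by ring_nf
    _ ≤ |dispersion L (k + 1) p - p ^ 2| + |dispersion L k p - p ^ 2| := abs_sub _ _
    _ ≤ 5 / 48 * p ^ 4 * (L⁻¹ ^ 2) ^ (k + 1) + 5 / 48 * p ^ 4 * (L⁻¹ ^ 2) ^ k := add_le_add h1 h2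
    _ ≤ 5 / 48 * p ^ 4 * (L⁻¹ ^ 2) ^ k + 5 / 48 * p ^ 4 * (L⁻¹ ^ 2) ^ k := by nlinarith [mul_le_mul_of_nonneg_left hpow hp4]
    _ = 5 / 24 * p ^ 4 * (L⁻¹ ^ 2) ^ k := by ring

/-- **NE4's OWN SHAPE FOR THE DISPERSION FAMILY**: the history-free family `β_{k+1}(g_0,…,g_k) := dispersion L (k+1) p` (`FlowStep.ofMarkov`) satisfies
`T4CouplingMatching.ScaleShiftRate ((5∕24)·p⁴·L⁻²) (L⁻²) γ β` for every box `γ` (`1 ≤ L`, `|p| ≤ 1`) — by `scaleShiftRate_ofMarkov_iff` and `dispersion_step_le` at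
`k + 1`.  A MODEL instance of the shape at the rate `θ = L⁻²`; NOT Bałaban's β. [folklore] -/
theorem scaleShiftRate_dispersion {L : ℝ} (hL : 1 ≤ L) {p : ℝ} (hp : |p| ≤ 1) (γ : ℝ) :
    ScaleShiftRate (5 / 24 * p ^ 4 * L⁻¹ ^ 2) (L⁻¹ ^ 2) γ (ofMarkov fun k _ => dispersion L k p) := by
  rw [scaleShiftRate_ofMarkov_iff]
  intro k g _ _
  have h := dispersion_step_le hL hp (k + 1)
  calc |dispersion L (k + 2) p - dispersion L (k + 1) p| ≤ 5 / 24 * p ^ 4 * (L⁻¹ ^ 2) ^ (k + 1) := h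
    _ = 5 / 24 * p ^ 4 * L⁻¹ ^ 2 * (L⁻¹ ^ 2) ^ k := by ring

end Sequence

/-! ## §4 The `d`-dimensional symbol -/

section Dim

variable {d : ℕ}

/-- THE `d`-DIMENSIONAL LATTICE SYMBOL `Σ_μ latSym N p_μ` (nearest-neighbour Laplacian on `(η ℤ)^d`, `η = 1∕N`). [folklore] -/
def latSymSum (N : ℝ) (p : Fin d → ℝ) : ℝ := ∑ μ, latSym N (p μ)

/-- **THE `d`-DIMENSIONAL ARTIFACT**: `|Σ_μ latSym N p_μ − Σ_μ p_μ²| ≤ (5∕48)·(Σ_μ p_μ⁴)∕N²` for `|p_μ| ≤ N`. [folklore] -/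
theorem abs_latSymSum_sub_le {N : ℝ} (hN : 0 < N) {p : Fin d → ℝ} (hp : ∀ μ, |p μ| ≤ N) :
    |latSymSum N p - ∑ μ, p μ ^ 2| ≤ 5 / 48 * (∑ μ, p μ ^ 4) / N ^ 2 := by
  rw [latSymSum, ← sum_sub_distrib, mul_sum, sum_div]
  refine (abs_sum_le_sum_abs _ _).trans (sum_le_sum fun μ _ => ?_)
  exact abs_latSym_sub_sq_le hN (hp μ)

/-- [bookkeeping] At the `k`-th scale (`N = L^k`, `1 ≤ L`, `|p_μ| ≤ 1`): `|Σ_μ latSym (L^k) p_μ − Σ_μ p_μ²| ≤ (5∕48)·(Σ_μ p_μ⁴)·(L⁻²)^k`. [folklore] -/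
theorem abs_latSymSum_scale_sub_le {L : ℝ} (hL : 1 ≤ L) {p : Fin d → ℝ} (hp : ∀ μ, |p μ| ≤ 1) (k : ℕ) :
    |latSymSum (L ^ k) p - ∑ μ, p μ ^ 2| ≤ 5 / 48 * (∑ μ, p μ ^ 4) * (L⁻¹ ^ 2) ^ k := by
  have hL0 : 0 < L := lt_of_lt_of_le one_pos hL
  have hN : 0 < L ^ k := pow_pos hL0 k
  have h := abs_latSymSum_sub_le hN (p := p) fun μ => (hp μ).trans (one_le_pow₀ hL)
  calc |latSymSum (L ^ k) p - ∑ μ, p μ ^ 2| ≤ 5 / 48 * (∑ μ, p μ ^ 4) / (L ^ k) ^ 2 := h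
    _ = 5 / 48 * (∑ μ, p μ ^ 4) * (L⁻¹ ^ 2) ^ k := by rw [div_eq_mul_inv, inv_sq_pow]

end Dim

/-! ## §5 (v2) The propagator form: the massive free lattice propagator's symbol converges at rate `η²` -/

section Propagator

/-- **THE PROPAGATOR FORM OF THE ARTIFACT**: for a mass `m > 0` and `|p| ≤ N`,
`|(m² + latSym N p)⁻¹ − (m² + p²)⁻¹| ≤ (5∕48)·p⁴∕(N²·m⁴)` — resolvent identity `a⁻¹ − b⁻¹ = (b − a)∕(ab)` with `a, b ≥ m²` and §2.  The scalar prototype of an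
η-DIFFERENCE bound for a lattice propagator (rows NE2∕NE3's objects for Bałaban's propagators are NOT touched). [folklore] -/
theorem abs_inv_massive_sub_le {N p m : ℝ} (hN : 0 < N) (hp : |p| ≤ N) (hm : 0 < m) :
    |(m ^ 2 + latSym N p)⁻¹ - (m ^ 2 + p ^ 2)⁻¹| ≤ 5 / 48 * p ^ 4 / (N ^ 2 * m ^ 4) := by
  have ha : m ^ 2 ≤ m ^ 2 + latSym N p := le_add_of_nonneg_right (latSym_nonneg N p)
  have hb : m ^ 2 ≤ m ^ 2 + p ^ 2 := le_add_of_nonneg_right (sq_nonneg p)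
  have hm2 : 0 < m ^ 2 := by positivity
  have ha0 : 0 < m ^ 2 + latSym N p := lt_of_lt_of_le hm2 ha
  have hb0 : 0 < m ^ 2 + p ^ 2 := lt_of_lt_of_le hm2 hb
  have e : (m ^ 2 + latSym N p)⁻¹ - (m ^ 2 + p ^ 2)⁻¹ = (p ^ 2 - latSym N p) / ((m ^ 2 + latSym N p) * (m ^ 2 + p ^ 2)) := by
    field_simp; ring
  rw [e, abs_div, abs_of_pos (mul_pos ha0 hb0), show |p ^ 2 - latSym N p| = |latSym N p - p ^ 2| from abs_sub_comm _ _]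
  have hprod : m ^ 2 * m ^ 2 ≤ (m ^ 2 + latSym N p) * (m ^ 2 + p ^ 2) := mul_le_mul ha hb hm2.le ha0.le
  calc |latSym N p - p ^ 2| / ((m ^ 2 + latSym N p) * (m ^ 2 + p ^ 2))
      ≤ (5 / 48 * p ^ 4 / N ^ 2) / (m ^ 2 * m ^ 2) := by
        refine div_le_div₀ (by positivity) (abs_latSym_sub_sq_le hN hp) (by positivity) hprod
    _ = 5 / 48 * p ^ 4 / (N ^ 2 * m ^ 4) := by field_simp

/-- [bookkeeping] At the `k`-th scale (`N = L^k`, `1 ≤ L`, `|p| ≤ 1`): `|(m² + dispersion L k p)⁻¹ − (m² + p²)⁻¹| ≤ (5∕48)·p⁴∕m⁴·(L⁻²)^k` — the massive free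
lattice propagator's symbol forgets the cutoff at rate `L⁻²` per step. [folklore] -/
theorem abs_inv_massive_scale_sub_le {L : ℝ} (hL : 1 ≤ L) {p : ℝ} (hp : |p| ≤ 1) {m : ℝ} (hm : 0 < m) (k : ℕ) :
    |(m ^ 2 + dispersion L k p)⁻¹ - (m ^ 2 + p ^ 2)⁻¹| ≤ 5 / 48 * p ^ 4 / m ^ 4 * (L⁻¹ ^ 2) ^ k := by
  have hL0 : 0 < L := lt_of_lt_of_le one_pos hL
  have hN : 0 < L ^ k := pow_pos hL0 k
  have h := abs_inv_massive_sub_le hN (hp.trans (one_le_pow₀ hL)) hm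
  rw [dispersion]
  calc |(m ^ 2 + latSym (L ^ k) p)⁻¹ - (m ^ 2 + p ^ 2)⁻¹| ≤ 5 / 48 * p ^ 4 / ((L ^ k) ^ 2 * m ^ 4) := h
    _ = 5 / 48 * p ^ 4 / m ^ 4 * (L⁻¹ ^ 2) ^ k := by
        rw [← inv_sq_pow, mul_comm ((L ^ k) ^ 2) (m ^ 4), ← div_div, div_eq_mul_inv _ ((L ^ k) ^ 2)]

end Propagator

/-! ## §6 (v2) Link to the tree's lattice dispersion `ε(p) = Σᵢ (1 − cos pᵢ)` -/

section Link

variable {d : ℕ}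

/-- **THE LINK**: `latSymSum N p = 2N²·ε(p∕N)` with `ε = Literature.Probability.LatticeModels.dispersion` — half the Fourier symbol of `−Δ` on `ℤ^d` (the tree's
`latticeLaplacianZd_cos_sum_mul`), here at spacing `1∕N` (momenta rescaled by `1∕N`, symbol by `N²`). [folklore] -/
theorem latSymSum_eq_dispersion (N : ℝ) (p : Fin d → ℝ) :
    latSymSum N p = 2 * N ^ 2 * Literature.Probability.LatticeModels.dispersion (fun μ => p μ / N) := by
  rw [latSymSum, Literature.Probability.LatticeModels.dispersion, mul_sum]
  rfl

/-- **§4's BOUND IN THE TREE's VOCABULARY**: `|2N²·ε(p∕N) − Σ_μ p_μ²| ≤ (5∕48)·(Σ_μ p_μ⁴)∕N²` for `|p_μ| ≤ N` — the scaled graph-Laplacian symbol of `ℤ^d` converges to the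
continuum symbol at rate `η² = N⁻²`. [folklore] -/
theorem abs_dispersionZd_scaled_sub_le {N : ℝ} (hN : 0 < N) {p : Fin d → ℝ} (hp : ∀ μ, |p μ| ≤ N) :
    |2 * N ^ 2 * Literature.Probability.LatticeModels.dispersion (fun μ => p μ / N) - ∑ μ, p μ ^ 2| ≤ 5 / 48 * (∑ μ, p μ ^ 4) / N ^ 2 := by
  rw [← latSymSum_eq_dispersion]
  exact abs_latSymSum_sub_le hN hp

end Link

end LatticeArtifact

end Summit.QuantumFields.BalabanUV.T4Continuum.Spine.NE4
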